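import Mathlib

/-!
# Route EIHFluxBalance — `ModulatedKerrHandoff`, stub `stub_dragDefect`: the order count

Helper file for the crux `stmt-FinalStateConjecture-10167`
(`Summit.FinalStateConjecture.FinalStateConjecture.Theses.EIHFluxBalance.ModulatedKerrHandoff`),
line `overlap-modulation-second-iterate`, stub `stub_dragDefect`.

The drag-defect estimate bounds the coordinate Ricci form of the dragged two-centre field at a
point of hole 1's buffer shell `{‖x̲‖ = d}`, `16 ε ≤ d ≤ D/8` (`D` the separation,
`ε = C (M₁ + M₂)`, `C ≥ 1` the universal Kerr–Schild decay constant), by a sum of products of jet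
sizes (the second-order Ricci expansion of `…DragDefectRicciExpansion` applied twice, plus the
Hessian of the drag error). This file is the pure real arithmetic ("order count") turning the
primitive jet bounds into `≤ 3·10⁵ ε² / (D² d²)`: every jet is a multiple of a power of `ε` over
powers of `d` and `D` (`arith_*`), and every product in the expansion carries at least `ε²/(d²D²)`
(`dragDefect_order_count`). No analysis.
-/

noncomputable section

-- `Summit.<S>.<S>.…` (single-problem summit, D-0017) trips core's duplicate-namespace linter.
set_option linter.dupNamespace false

namespace Summit.FinalStateConjecture.FinalStateConjecture.Theorems

namespace DragDefect

section Arith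

variable {ε d D K₁ K₂ a E₀ E₁ E₂ H₀ H₁ H₂ b₁ b₂ g p₁ p₂ q₀ : ℝ}

/-- Fractions with a common positive denominator: `x/c ≤ y/c ↔ x ≤ y`. [folklore] -/
theorem arith_div_le_div {x y c : ℝ} (hc : 0 < c) (h : x ≤ y) : x / c ≤ y / c :=
  div_le_div_of_nonneg_right h hc.le

/-- Shrinking a positive denominator: `x/c₂ ≤ x/c₁` for `0 < c₁ ≤ c₂`, `0 ≤ x`. [folklore] -/
theorem arith_div_le_div_left {x c₁ c₂ : ℝ} (hx : 0 ≤ x) (hc₁ : 0 < c₁) (h : c₁ ≤ c₂) :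
    x / c₂ ≤ x / c₁ :=
  div_le_div_of_nonneg_left hx hc₁ h

/-- **The drag is small**: `a² ≤ ε d/(64 D²)` and `K₁ a² ≤ ε d²/(1024 D²)`, `K₁a² ≤ ε² d/(64 D²)`.
[folklore] -/
theorem arith_drag (hd : 0 < d) (hD : 8 * d ≤ D) (hε : 16 * ε ≤ d) (hε0 : 0 ≤ ε)
    (hK₁ : K₁ ≤ ε) (ha0 : 0 ≤ a) (ha : a ≤ ε / (2 * D)) :
    a ^ 2 ≤ ε * d / (64 * D ^ 2) ∧ K₁ * a ^ 2 ≤ ε * d ^ 2 / (1024 * D ^ 2) ∧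
      K₁ * a ^ 2 ≤ ε ^ 2 * d / (64 * D ^ 2) ∧ a ≤ 1 := by
  have hD0 : 0 < D := by linarith
  have ha2 : a ^ 2 ≤ ε ^ 2 / (4 * D ^ 2) := by
    calc a ^ 2 ≤ (ε / (2 * D)) ^ 2 := pow_le_pow_left₀ ha0 ha 2
      _ = ε ^ 2 / (4 * D ^ 2) := by field_simp; try ring
  refine ⟨?_, ?_, ?_, ?_⟩
  · calc a ^ 2 ≤ ε ^ 2 / (4 * D ^ 2) := ha2
      _ = ε * ε / (4 * D ^ 2) := by ring
      _ ≤ ε * (d / 16) / (4 * D ^ 2) := by gcongr; linarith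
      _ = ε * d / (64 * D ^ 2) := by ring
  · calc K₁ * a ^ 2 ≤ ε * (ε ^ 2 / (4 * D ^ 2)) := mul_le_mul hK₁ ha2 (by positivity) hε0
      _ = ε * (ε * ε) / (4 * D ^ 2) := by ring
      _ ≤ ε * ((d / 16) * (d / 16)) / (4 * D ^ 2) := by gcongr <;> linarith
      _ = ε * d ^ 2 / (1024 * D ^ 2) := by ring
  · calc K₁ * a ^ 2 ≤ ε * (ε ^ 2 / (4 * D ^ 2)) := mul_le_mul hK₁ ha2 (by positivity) hε0
      _ = ε ^ 2 * ε / (4 * D ^ 2) := by ring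
      _ ≤ ε ^ 2 * (d / 16) / (4 * D ^ 2) := by gcongr; linarith
      _ = ε ^ 2 * d / (64 * D ^ 2) := by ring
  · calc a ≤ ε / (2 * D) := ha
      _ ≤ 1 := by rw [div_le_one (by positivity)]; linarith

/-- **The drag-error jets**: `E₀ ≤ εd/(56D²)`, `E₁ ≤ ε/(18D²)`, `E₂ ≤ 3ε²/(D²d²)`, `E₂ ≤ ε/(5D²d)`.
[folklore] -/
theorem arith_dragError (hd : 0 < d) (hD : 8 * d ≤ D) (hε : 16 * ε ≤ d) (hε0 : 0 ≤ ε)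
    (hK₁ : K₁ ≤ ε) (ha0 : 0 ≤ a) (ha : a ≤ ε / (2 * D))
    (hE₀ : E₀ ≤ 18 * K₁ * a ^ 2 / d) (hE₁ : E₁ ≤ 56 * K₁ * a ^ 2 / d ^ 2)
    (hE₂ : E₂ ≤ 184 * K₁ * a ^ 2 / d ^ 3) :
    E₀ ≤ ε * d / (56 * D ^ 2) ∧ E₁ ≤ ε / (18 * D ^ 2) ∧ E₂ ≤ 3 * ε ^ 2 / (D ^ 2 * d ^ 2) ∧
      E₂ ≤ ε / (5 * D ^ 2 * d) := by
  have hD0 : 0 < D := by linarith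
  obtain ⟨-, hKa, hKa', -⟩ := arith_drag hd hD hε hε0 hK₁ ha0 ha
  have hE₂' : E₂ ≤ 3 * ε ^ 2 / (D ^ 2 * d ^ 2) := by
    calc E₂ ≤ 184 * K₁ * a ^ 2 / d ^ 3 := hE₂
      _ = 184 * (K₁ * a ^ 2) / d ^ 3 := by ring
      _ ≤ 184 * (ε ^ 2 * d / (64 * D ^ 2)) / d ^ 3 := by gcongr
      _ = (184 / 64) * (ε ^ 2 / (D ^ 2 * d ^ 2)) := by field_simp
      _ ≤ 3 * (ε ^ 2 / (D ^ 2 * d ^ 2)) :=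
          mul_le_mul_of_nonneg_right (by norm_num) (by positivity)
      _ = _ := by ring
  refine ⟨?_, ?_, hE₂', ?_⟩
  · calc E₀ ≤ 18 * K₁ * a ^ 2 / d := hE₀
      _ = 18 * (K₁ * a ^ 2) / d := by ring
      _ ≤ 18 * (ε * d ^ 2 / (1024 * D ^ 2)) / d := by gcongr
      _ = (18 / 1024) * (ε * d / D ^ 2) := by field_simp
      _ ≤ (1 / 56) * (ε * d / D ^ 2) :=
          mul_le_mul_of_nonneg_right (by norm_num) (by positivity)
      _ = _ := by ring
  · calc E₁ ≤ 56 * K₁ * a ^ 2 / d ^ 2 := hE₁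
      _ = 56 * (K₁ * a ^ 2) / d ^ 2 := by ring
      _ ≤ 56 * (ε * d ^ 2 / (1024 * D ^ 2)) / d ^ 2 := by gcongr
      _ = (56 / 1024) * (ε / D ^ 2) := by field_simp
      _ ≤ (1 / 18) * (ε / D ^ 2) :=
          mul_le_mul_of_nonneg_right (by norm_num) (by positivity)
      _ = _ := by ring
  · calc E₂ ≤ 3 * ε ^ 2 / (D ^ 2 * d ^ 2) := hE₂'
      _ = 3 * (ε * ε) / (D ^ 2 * d ^ 2) := by ring
      _ ≤ 3 * (ε * (d / 16)) / (D ^ 2 * d ^ 2) := by gcongr; linarith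
      _ = (3 / 16) * (ε / (D ^ 2 * d)) := by field_simp
      _ ≤ (1 / 5) * (ε / (D ^ 2 * d)) :=
          mul_le_mul_of_nonneg_right (by norm_num) (by positivity)
      _ = _ := by ring

/-- **The perturbation and background jets**: `H₀ ≤ 5εd/D²`, `H₁ ≤ 5ε/D²`, `H₂ ≤ 2ε/(D²d)`,
`b₁ + H₁ ≤ 33ε/d²`, `b₂ + H₂ ≤ 129ε/d³`, `g ≤ 9ε/d`. [folklore] -/
theorem arith_jets (hd : 0 < d) (hD : 8 * d ≤ D) (hε : 16 * ε ≤ d) (hε0 : 0 ≤ ε)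
    (hK₁ : K₁ ≤ ε) (hK₂ : K₂ ≤ ε) (ha0 : 0 ≤ a) (ha : a ≤ ε / (2 * D))
    (hE₀ : E₀ ≤ 18 * K₁ * a ^ 2 / d) (hE₁ : E₁ ≤ 56 * K₁ * a ^ 2 / d ^ 2)
    (hE₂ : E₂ ≤ 184 * K₁ * a ^ 2 / d ^ 3)
    (hH₀ : H₀ ≤ 4 * K₂ * d / D ^ 2 + a ^ 2 + E₀) (hH₁ : H₁ ≤ 4 * K₂ / D ^ 2 + E₁)
    (hH₂ : H₂ ≤ 8 * K₂ / D ^ 3 + E₂)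
    (hb₁ : b₁ ≤ 32 * K₁ / d ^ 2) (hb₂ : b₂ ≤ 128 * K₁ / d ^ 3)
    (hg : g ≤ ε / D + a ^ 2 + 8 * K₁ / d) :
    H₀ ≤ 5 * ε * d / D ^ 2 ∧ H₁ ≤ 5 * ε / D ^ 2 ∧ H₂ ≤ 2 * ε / (D ^ 2 * d) ∧
      b₁ + H₁ ≤ 33 * ε / d ^ 2 ∧ b₂ + H₂ ≤ 129 * ε / d ^ 3 ∧ g ≤ 9 * ε / d := by
  have hD0 : 0 < D := by linarith
  obtain ⟨ha2, -, -, -⟩ := arith_drag hd hD hε hε0 hK₁ ha0 ha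
  obtain ⟨hE₀', hE₁', -, hE₂'⟩ := arith_dragError hd hD hε hε0 hK₁ ha0 ha hE₀ hE₁ hE₂
  have hd2 : 64 * d ^ 2 ≤ D ^ 2 := by nlinarith only [hD, hd]
  have hd3 : 8 * d * D ^ 2 ≤ D ^ 3 := by
    calc 8 * d * D ^ 2 ≤ D * D ^ 2 := mul_le_mul_of_nonneg_right hD (by positivity)
      _ = D ^ 3 := by ring
  -- `H₀`
  have hH₀' : H₀ ≤ 5 * ε * d / D ^ 2 := by
    calc H₀ ≤ 4 * K₂ * d / D ^ 2 + a ^ 2 + E₀ := hH₀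
      _ ≤ 4 * ε * d / D ^ 2 + ε * d / (64 * D ^ 2) + ε * d / (56 * D ^ 2) := by gcongr
      _ = (4 + 1 / 64 + 1 / 56) * (ε * d / D ^ 2) := by field_simp; try ring
      _ ≤ 5 * (ε * d / D ^ 2) := mul_le_mul_of_nonneg_right (by norm_num) (by positivity)
      _ = _ := by ring
  -- `H₁`
  have hH₁' : H₁ ≤ 5 * ε / D ^ 2 := by
    calc H₁ ≤ 4 * K₂ / D ^ 2 + E₁ := hH₁
      _ ≤ 4 * ε / D ^ 2 + ε / (18 * D ^ 2) := by gcongr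
      _ = (4 + 1 / 18) * (ε / D ^ 2) := by field_simp; try ring
      _ ≤ 5 * (ε / D ^ 2) := mul_le_mul_of_nonneg_right (by norm_num) (by positivity)
      _ = _ := by ring
  -- `H₂`
  have hH₂' : H₂ ≤ 2 * ε / (D ^ 2 * d) := by
    have h1 : 8 * ε / D ^ 3 ≤ 8 * ε / (8 * d * D ^ 2) :=
      arith_div_le_div_left (by positivity) (by positivity) hd3
    calc H₂ ≤ 8 * K₂ / D ^ 3 + E₂ := hH₂
      _ ≤ 8 * ε / D ^ 3 + ε / (5 * D ^ 2 * d) := by gcongr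
      _ ≤ 8 * ε / (8 * d * D ^ 2) + ε / (5 * D ^ 2 * d) := add_le_add h1 le_rfl
      _ = (1 + 1 / 5) * (ε / (D ^ 2 * d)) := by field_simp; try ring
      _ ≤ 2 * (ε / (D ^ 2 * d)) := mul_le_mul_of_nonneg_right (by norm_num) (by positivity)
      _ = _ := by ring
  refine ⟨hH₀', hH₁', hH₂', ?_, ?_, ?_⟩
  · have h1 : 5 * ε / D ^ 2 ≤ 5 * ε / (64 * d ^ 2) :=
      arith_div_le_div_left (by positivity) (by positivity) hd2
    calc b₁ + H₁ ≤ 32 * K₁ / d ^ 2 + 5 * ε / D ^ 2 := add_le_add hb₁ hH₁'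
      _ ≤ 32 * ε / d ^ 2 + 5 * ε / (64 * d ^ 2) := by gcongr
      _ = (32 + 5 / 64) * (ε / d ^ 2) := by field_simp; try ring
      _ ≤ 33 * (ε / d ^ 2) := mul_le_mul_of_nonneg_right (by norm_num) (by positivity)
      _ = _ := by ring
  · have h1 : 2 * ε / (D ^ 2 * d) ≤ 2 * ε / (64 * d ^ 2 * d) :=
      arith_div_le_div_left (by positivity) (by positivity)
        (by nlinarith only [hd2, hd])
    calc b₂ + H₂ ≤ 128 * K₁ / d ^ 3 + 2 * ε / (D ^ 2 * d) := add_le_add hb₂ hH₂'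
      _ ≤ 128 * ε / d ^ 3 + 2 * ε / (64 * d ^ 2 * d) := by gcongr
      _ = (128 + 2 / 64) * (ε / d ^ 3) := by field_simp; try ring
      _ ≤ 129 * (ε / d ^ 3) := mul_le_mul_of_nonneg_right (by norm_num) (by positivity)
      _ = _ := by ring
  · have h1 : ε / D ≤ ε / (8 * d) := arith_div_le_div_left hε0 (by positivity) hD
    have h2 : ε * d / (64 * D ^ 2) ≤ ε * d / (64 * (64 * d ^ 2)) :=
      arith_div_le_div_left (by positivity) (by positivity)
        (by nlinarith only [hd2, hd])
    calc g ≤ ε / D + a ^ 2 + 8 * K₁ / d := hg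
      _ ≤ ε / (8 * d) + ε * d / (64 * (64 * d ^ 2)) + 8 * ε / d := by
          gcongr
          · exact ha2.trans h2
      _ = (1 / 8 + 1 / (64 * 64) + 8) * (ε / d) := by field_simp; try ring
      _ ≤ 9 * (ε / d) := mul_le_mul_of_nonneg_right (by norm_num) (by positivity)
      _ = _ := by ring

/-- **The order count of the drag defect** (see the module docstring). [folklore] -/
theorem dragDefect_order_count (hd : 0 < d) (hD : 8 * d ≤ D) (hε : 16 * ε ≤ d) (hε0 : 0 ≤ ε)
    (hK₁ : K₁ ≤ ε) (hK₂ : K₂ ≤ ε)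
    (ha0 : 0 ≤ a) (ha : a ≤ ε / (2 * D))
    (hE₀ : E₀ ≤ 18 * K₁ * a ^ 2 / d) (hE₁ : E₁ ≤ 56 * K₁ * a ^ 2 / d ^ 2)
    (hE₂ : E₂ ≤ 184 * K₁ * a ^ 2 / d ^ 3)
    (hH₀0 : 0 ≤ H₀) (hH₀ : H₀ ≤ 4 * K₂ * d / D ^ 2 + a ^ 2 + E₀)
    (hH₁0 : 0 ≤ H₁) (hH₁ : H₁ ≤ 4 * K₂ / D ^ 2 + E₁)
    (hH₂0 : 0 ≤ H₂) (hH₂ : H₂ ≤ 8 * K₂ / D ^ 3 + E₂)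
    (hb₁0 : 0 ≤ b₁) (hb₁ : b₁ ≤ 32 * K₁ / d ^ 2) (hb₂ : b₂ ≤ 128 * K₁ / d ^ 3)
    (hg : g ≤ ε / D + a ^ 2 + 8 * K₁ / d)
    (hp₁0 : 0 ≤ p₁) (hp₁ : p₁ ≤ 4 * K₂ / D ^ 2) (hp₂ : p₂ ≤ 8 * K₂ / D ^ 3)
    (hq₀0 : 0 ≤ q₀) (hq₀ : q₀ ≤ 2 * K₂ / D) :
    4 * ((120 * (b₁ + H₁) ^ 2 + 12 * (b₂ + H₂)) * H₀ + 60 * (b₁ + H₁) * H₁ + 6 * g * H₂)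
      + 4 * ((120 * p₁ ^ 2 + 12 * p₂) * q₀ + 60 * p₁ * p₁) + 12 * E₂ ≤
      300000 * ε ^ 2 / (D ^ 2 * d ^ 2) := by
  have hD0 : 0 < D := by linarith
  obtain ⟨-, -, hE₂', -⟩ := arith_dragError hd hD hε hε0 hK₁ ha0 ha hE₀ hE₁ hE₂
  obtain ⟨hH₀', hH₁', hH₂', hbH₁, hbH₂, hg'⟩ :=
    arith_jets hd hD hε hε0 hK₁ hK₂ ha0 ha hE₀ hE₁ hE₂ hH₀ hH₁ hH₂ hb₁ hb₂ hg
  have hbH₁0 : 0 ≤ b₁ + H₁ := add_nonneg hb₁0 hH₁0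
  have hεd : ε ≤ d / 16 := by linarith
  set S := ε ^ 2 / (D ^ 2 * d ^ 2) with hS
  have hS0 : 0 ≤ S := by positivity
  -- `ε³/(d³D²) ≤ S/16`
  have hcube : ε ^ 3 / (D ^ 2 * d ^ 3) ≤ S / 16 := by
    rw [hS]
    calc ε ^ 3 / (D ^ 2 * d ^ 3) = ε ^ 2 * ε / (D ^ 2 * d ^ 3) := by ring
      _ ≤ ε ^ 2 * (d / 16) / (D ^ 2 * d ^ 3) := by gcongr
      _ = ε ^ 2 / (D ^ 2 * d ^ 2) / 16 := by field_simp
  -- term by term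
  have hε33 : 0 ≤ 33 * ε / d ^ 2 := by positivity
  have t1 : 120 * (b₁ + H₁) ^ 2 * H₀ ≤ 653400 * (S / 16) := by
    have e1 : (b₁ + H₁) ^ 2 ≤ (33 * ε / d ^ 2) ^ 2 := pow_le_pow_left₀ hbH₁0 hbH₁ 2
    calc 120 * (b₁ + H₁) ^ 2 * H₀ ≤ 120 * (33 * ε / d ^ 2) ^ 2 * (5 * ε * d / D ^ 2) :=
          mul_le_mul (mul_le_mul_of_nonneg_left e1 (by norm_num)) hH₀' hH₀0 (by positivity)
      _ = 653400 * (ε ^ 3 / (D ^ 2 * d ^ 3)) := by field_simp; try ring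
      _ ≤ 653400 * (S / 16) := mul_le_mul_of_nonneg_left hcube (by norm_num)
  have t2 : 12 * (b₂ + H₂) * H₀ ≤ 7740 * S := by
    calc 12 * (b₂ + H₂) * H₀ ≤ 12 * (129 * ε / d ^ 3) * (5 * ε * d / D ^ 2) :=
          mul_le_mul (mul_le_mul_of_nonneg_left hbH₂ (by norm_num)) hH₀' hH₀0 (by positivity)
      _ = 7740 * S := by rw [hS]; field_simp; try ring
  have t3 : 60 * (b₁ + H₁) * H₁ ≤ 9900 * S := by
    calc 60 * (b₁ + H₁) * H₁ ≤ 60 * (33 * ε / d ^ 2) * (5 * ε / D ^ 2) :=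
          mul_le_mul (mul_le_mul_of_nonneg_left hbH₁ (by norm_num)) hH₁' hH₁0 (by positivity)
      _ = 9900 * S := by rw [hS]; field_simp; try ring
  have t4 : 6 * g * H₂ ≤ 108 * S := by
    calc 6 * g * H₂ ≤ 6 * (9 * ε / d) * (2 * ε / (D ^ 2 * d)) :=
          mul_le_mul (mul_le_mul_of_nonneg_left hg' (by norm_num)) hH₂' hH₂0 (by positivity)
      _ = 108 * S := by rw [hS]; field_simp; try ring
  have hD5 : D ^ 2 * (8 * d) ^ 3 ≤ D ^ 5 := by
    have h3 : (8 * d) ^ 3 ≤ D ^ 3 := pow_le_pow_left₀ (by positivity) hD 3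
    calc D ^ 2 * (8 * d) ^ 3 ≤ D ^ 2 * D ^ 3 := mul_le_mul_of_nonneg_left h3 (by positivity)
      _ = D ^ 5 := by ring
  have hD4 : D ^ 2 * (64 * d ^ 2) ≤ D ^ 4 := by
    have h2 : 64 * d ^ 2 ≤ D ^ 2 := by nlinarith only [hD, hd]
    calc D ^ 2 * (64 * d ^ 2) ≤ D ^ 2 * D ^ 2 := mul_le_mul_of_nonneg_left h2 (by positivity)
      _ = D ^ 4 := by ring
  have hp₁' : p₁ ≤ 4 * ε / D ^ 2 := hp₁.trans (by gcongr)
  have hp₂' : p₂ ≤ 8 * ε / D ^ 3 := hp₂.trans (by gcongr)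
  have hq₀' : q₀ ≤ 2 * ε / D := hq₀.trans (by gcongr)
  have t5 : 120 * p₁ ^ 2 * q₀ ≤ 8 * (S / 16) := by
    have e1 : p₁ ^ 2 ≤ (4 * ε / D ^ 2) ^ 2 := pow_le_pow_left₀ hp₁0 hp₁' 2
    calc 120 * p₁ ^ 2 * q₀ ≤ 120 * (4 * ε / D ^ 2) ^ 2 * (2 * ε / D) :=
          mul_le_mul (mul_le_mul_of_nonneg_left e1 (by norm_num)) hq₀' hq₀0 (by positivity)
      _ = 3840 * ε ^ 3 / D ^ 5 := by field_simp; try ring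
      _ ≤ 3840 * ε ^ 3 / (D ^ 2 * (8 * d) ^ 3) :=
          arith_div_le_div_left (by positivity) (by positivity) hD5
      _ = (3840 / 512) * (ε ^ 3 / (D ^ 2 * d ^ 3)) := by field_simp; try ring
      _ ≤ 8 * (S / 16) := by
          rw [hS]; exact (mul_le_mul_of_nonneg_right (by norm_num) (by positivity)).trans
            (mul_le_mul_of_nonneg_left hcube (by norm_num))
  have t6 : 12 * p₂ * q₀ ≤ 3 * S := by
    calc 12 * p₂ * q₀ ≤ 12 * (8 * ε / D ^ 3) * (2 * ε / D) :=
          mul_le_mul (mul_le_mul_of_nonneg_left hp₂' (by norm_num)) hq₀' hq₀0 (by positivity)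
      _ = 192 * ε ^ 2 / D ^ 4 := by field_simp; try ring
      _ ≤ 192 * ε ^ 2 / (D ^ 2 * (64 * d ^ 2)) :=
          arith_div_le_div_left (by positivity) (by positivity) hD4
      _ = 3 * S := by rw [hS]; field_simp; try ring
  have t7 : 60 * p₁ * p₁ ≤ 15 * S := by
    calc 60 * p₁ * p₁ ≤ 60 * (4 * ε / D ^ 2) * (4 * ε / D ^ 2) :=
          mul_le_mul (mul_le_mul_of_nonneg_left hp₁' (by norm_num)) hp₁' hp₁0 (by positivity)
      _ = 960 * ε ^ 2 / D ^ 4 := by field_simp; try ring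
      _ ≤ 960 * ε ^ 2 / (D ^ 2 * (64 * d ^ 2)) :=
          arith_div_le_div_left (by positivity) (by positivity) hD4
      _ = 15 * S := by rw [hS]; field_simp; try ring
  have t8 : 12 * E₂ ≤ 36 * S := by
    have e : 3 * ε ^ 2 / (D ^ 2 * d ^ 2) = 3 * S := by rw [hS]; ring
    linarith [hE₂', e]
  have hsum : 4 * ((120 * (b₁ + H₁) ^ 2 + 12 * (b₂ + H₂)) * H₀ + 60 * (b₁ + H₁) * H₁ + 6 * g * H₂)
      + 4 * ((120 * p₁ ^ 2 + 12 * p₂) * q₀ + 60 * p₁ * p₁) + 12 * E₂ ≤ 300000 * S := by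
    linarith [t1, t2, t3, t4, t5, t6, t7, t8]
  calc _ ≤ 300000 * S := hsum
    _ = _ := by rw [hS]; ring

/-- **Registered sub-goal form** (stub `dragDefect_order_count_reg` of the crux item) of
`dragDefect_order_count`. [folklore] -/
theorem dragDefect_order_count_reg : ∀ {ε d D K₁ K₂ a E₀ E₁ E₂ H₀ H₁ H₂ b₁ b₂ g p₁ p₂ q₀ : ℝ}, 0 < d → 8 * d ≤ D → 16 * ε ≤ d → 0 ≤ ε → K₁ ≤ ε → K₂ ≤ ε → 0 ≤ a → a ≤ ε / (2 * D) → E₀ ≤ 18 * K₁ * a ^ 2 / d → E₁ ≤ 56 * K₁ * a ^ 2 / d ^ 2 → E₂ ≤ 184 * K₁ * a ^ 2 / d ^ 3 → 0 ≤ H₀ → H₀ ≤ 4 * K₂ * d / D ^ 2 + a ^ 2 + E₀ → 0 ≤ H₁ → H₁ ≤ 4 * K₂ / D ^ 2 + E₁ → 0 ≤ H₂ → H₂ ≤ 8 * K₂ / D ^ 3 + E₂ → 0 ≤ b₁ → b₁ ≤ 32 * K₁ / d ^ 2 → b₂ ≤ 128 * K₁ / d ^ 3 → g ≤ ε / D +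 a ^ 2 + 8 * K₁ / d → 0 ≤ p₁ → p₁ ≤ 4 * K₂ / D ^ 2 → p₂ ≤ 8 * K₂ / D ^ 3 → 0 ≤ q₀ → q₀ ≤ 2 * K₂ / D → 4 * ((120 * (b₁ + H₁) ^ 2 + 12 * (b₂ + H₂)) * H₀ + 60 * (b₁ + H₁) * H₁ + 6 * g * H₂) + 4 * ((120 * p₁ ^ 2 + 12 * p₂) * q₀ + 60 * p₁ * p₁) + 12 * E₂ ≤ 300000 * ε ^ 2 / (D ^ 2 * d ^ 2) :=
  fun hd hD hε hε0 hK₁ hK₂ ha0 ha hE₀ hE₁ hE₂ hH₀0 hH₀ hH₁0 hH₁ hH₂0 hH₂ hb₁0 hb₁ hb₂ hg hp₁0 hp₁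
    hp₂ hq₀0 hq₀ ↦ dragDefect_order_count hd hD hε hε0 hK₁ hK₂ ha0 ha hE₀ hE₁ hE₂ hH₀0 hH₀ hH₁0 hH₁
    hH₂0 hH₂ hb₁0 hb₁ hb₂ hg hp₁0 hp₁ hp₂ hq₀0 hq₀

end Arith

end DragDefect

end Summit.FinalStateConjecture.FinalStateConjecture.Theorems

end
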